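import Literature.NumberTheory.Transcendental.ZudilinPhiTable1
import Literature.NumberTheory.Transcendental.ZudilinPhiTable2
import Literature.NumberTheory.Transcendental.ZudilinPhiTable3
import Literature.NumberTheory.Transcendental.ZudilinPhiTable4
import HarnessLib

/-!
# The table of Zudilin's `φ` (Theorem 3 parameters): assembly and the numerical constant

Topic `Literature/NumberTheory/Transcendental`. The full certificate `Zudilin2004.PhiCert.table`
(889 open cells covering `(2/91, 1)` minus the break points, [Zudilin2004, p. 271]) with

* `table_check` — every cell passes the strip checker, so `φ₀(x, y) ≥ c` on it (parts 1–4);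
* `table_adm`, `table_chain` — the cells are admissible (`0 < u < v ≤ 1`, `c ≥ 0`) and sorted;
* `tableLB_gt` — the kernel-certified inequality
  `Σ_{cells} c · Σ_{k=0}^{K} (1/(k+u) − 1/(k+v)) > c₂ = c2num/c2den = 176.6` (`K = 40`; the terms with
  `k = 0`, `u < 1/33` excluded), a truncation of Zudilin's
  `∫₀¹ φ dψ − ∫₀^{1/33} φ dx/x² = 176.75055734…` ([Zudilin2004, p. 271]: `C₂ = 3·35+34+8·33 −
  (∫₀¹ φ dψ − ∫₀^{1/33} φ dx/x²) = 226.24944266…`).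

Everything here is PROVED by kernel computation (no named facts).

## References

* [Zudilin2004] W. Zudilin, *Arithmetic of linear forms involving odd zeta values*, J. Théor.
  Nombres Bordeaux 16 (2004), 251–291, §8, p. 270–271 (Proposition 5, proof of Theorem 3).
-/

namespace Literature.NumberTheory.Transcendental

namespace Zudilin2004

namespace PhiCert

/-! ### The table -/

/-- The certificate for `φ` on `(0, 1)`: 889 cells. [cite: Zudilin2004, §8 p. 271] -/
def table : List Cell := cells1 ++ cells2 ++ cells3 ++ cells4

/-- Every cell of the table passes the strip checker. [cite: Zudilin2004, §8 p. 271] -/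
theorem table_check : ∀ C ∈ table, C.check = true := by
  rw [table]
  exact List.forall_mem_append.2 ⟨List.forall_mem_append.2 ⟨List.forall_mem_append.2
    ⟨cells1_check, cells2_check⟩, cells3_check⟩, cells4_check⟩

/-- Admissibility of a cell: `0 < b₀ ≤ 91`, `0 < b₁`, `0 < a₀`, `a₀/b₀ < a₁/b₁ ≤ 1`, `0 ≤ c`. [folklore] -/
def Cell.adm (C : Cell) : Bool :=
  decide (0 < C.b0) && decide (C.b0 ≤ 91) && decide (0 < C.b1) && decide (0 < C.a0)
    && decide (C.a0 * C.b1 < C.a1 * C.b0) && decide (C.a1 ≤ (C.b1 : ℤ)) && decide (0 ≤ C.c)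

/-- All cells are admissible. [cite: Zudilin2004, §8 p. 271] -/
theorem table_adm : table.all Cell.adm = true := by decide +kernel

/-- `C` lies to the left of `C'`: `a₁/b₁ ≤ a₀'/b₀'`. [folklore] -/
def Cell.before (C C' : Cell) : Bool := decide (C.a1 * C'.b0 ≤ C'.a0 * C.b1)

/-- Consecutive-pairs check of a relation along a list. [folklore] -/
def chainB {α : Type*} (r : α → α → Bool) : List α → Bool
  | [] => true
  | [_] => true
  | a :: b :: l => r a b && chainB r (b :: l)

/-- The cells are sorted from left to right. [cite: Zudilin2004, §8 p. 271] -/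
theorem table_chain : chainB Cell.before table = true := by decide +kernel

/-! ### The numerical constant -/

/-- Truncation of the sum over `k = ⌊n/p⌋`. [folklore] -/
def K : ℕ := 40

/-- Fixed-point scale of the certified lower bound. [folklore] -/
def M : ℕ := 10 ^ 9

/-- Numerator of `c₂ = 176.6`. [cite: Zudilin2004, §8 p. 271] -/
def c2num : ℕ := 883

/-- Denominator of `c₂ = 176.6`. [cite: Zudilin2004, §8 p. 271] -/
def c2den : ℕ := 5

/-- The pairs `(k, cell)` that contribute: primes `p ≤ 33n`, i.e. `k ≥ 1` or `u ≥ 1/33`. [cite: Zudilin2004, §8 (8.8)] -/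
def Cell.good (k : ℕ) (C : Cell) : Bool := decide (1 ≤ k) || decide ((C.b0 : ℤ) ≤ 33 * C.a0)

/-- `M`-scaled integer lower bound for `c · (1/(k+u) − 1/(k+v))`. [folklore] -/
def Cell.lbTerm (k : ℕ) (C : Cell) : ℤ :=
  C.c * (((M : ℤ) * C.b0) / ((k : ℤ) * C.b0 + C.a0))
    - C.c * ((((M : ℤ) * C.b1) + ((k : ℤ) * C.b1 + C.a1) - 1) / ((k : ℤ) * C.b1 + C.a1))

/-- The contribution of one cell, summed over `k ≤ K`. [folklore] -/
def Cell.lbSum (C : Cell) : ℤ :=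
  ((List.range (K + 1)).map fun k => if C.good k then C.lbTerm k else 0).sum

/-- The `M`-scaled certified lower bound of the table. [folklore] -/
def tableLB : ℤ := (table.map Cell.lbSum).sum

/-- **The certified constant**: `tableLB / M > c₂ = 176.6` (the value is `176.6335…`; about a minute of
kernel time). [cite: Zudilin2004, §8 p. 271] -/
theorem tableLB_gt : (c2num : ℤ) * M < c2den * tableLB := by decide +kernel

end PhiCert

end Zudilin2004

end Literature.NumberTheory.Transcendental
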